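import Summits.CriticalPhenomena.PercolationContinuityZ3.Theorems.PercNearOneGluingNoHeavyQuantFarFourOneLeSix
import Summits.CriticalPhenomena.PercolationContinuityZ3.Theorems.PercNearOneGluingNoHeavyQuantFarKronF51S6
import Summits.CriticalPhenomena.PercolationContinuityZ3.Theorems.PercNearOneGluingNoHeavyQuantFarLeFive
import Summits.CriticalPhenomena.PercolationContinuityZ3.Theorems.PercNearOneGluingNoHeavyLowerTailTwoCopyFin6
import Summits.CriticalPhenomena.PercolationContinuityZ3.Theorems.PercNearOneGluingNoHeavyQuantFarRelayRowReductions
import HarnessLib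

/-!
# FAR (`Quant.FarRelayRow`) at layer `1` with five relays on at most SIX vertices

builds on p205010 (kernel theorem, internal audit signed; external expert review pending)

Support file (`--supports stmt-CriticalPhenomena-4575`), seat `prim-cert-1` (gen 9).  COMPUTATIONAL by inheritance (the Kronecker-checked
certificate instance `FarKron.f51s6_check` uses `native_decide`).  Companion of `…QuantFarFourOneLeSix` (`|A| = 4`).
* `TwoCopy.farp_five_one_of_card_le_six` — FAR for `|A| = 5`, `j = 1` on every weighted graph with `n ≤ 6` vertices
  (`o ∈ A` elementary; `o ∉ A` forces `n = 6`, `A = univ ∖ {o}`: the Kronecker-checked `K6` certificate `FarKron.f51s6_canon`);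
in `Quant.FarRelayRow`'s exact shape: `farRelayRow_five_one_of_card_le_six`.
* Layer-2 corollaries by the observer shift `FARp.succ_of_erase` (`o ∈ A`: `N_A = N_{A∖o} + 1`, census-1's `QuantCensus` helpers):
  `farp_five_two_of_mem_of_card_le_six` (`|A| = 5`, `j = 2`, `o ∈ A`) and `farp_six_two_of_card_le_six` (`|A| = 6`, `j = 2`), `n ≤ 6`.
  With …QuantFarLeFive / …QuantFarFourOneLeSix this settles every FAR cell on `n ≤ 6` vertices EXCEPT `(|A|, j) = (3, 1)` with two Steiner
  vertices and `(5, 2)` with `o ∉ A`, for which NO bidegree-2 certificate exists (kit j099102/j099271, j099101).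
(`|A| = 3`, `j = 1` — `Z(3,2)` — has NO plain two-copy certificate on six vertices, kit j099102; nor has `|A| = 5`, `j = 2`, kit j099101.)
[cite: KozmaNitzan2024, Lemma 2 (p. 6), Conjecture 3 (p. 15)] (context; FAR is this programme's statement).
-/

namespace Summit.CriticalPhenomena.PercolationContinuityZ3.Theorems.TwoCopy

open Finset MeasureTheory
open Literature.Probability.Percolation Literature.Probability.LatticeModels
open Summit.CriticalPhenomena.PercolationContinuityZ3.Theorems.AdditiveGluing.Negative.Cert
open scoped Classical

variable {n : ℕ}

/-- `[1,2,3,4,5]` enumerates `univ ∖ {0}` in `Fin 6`. [this work] -/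
theorem toFinset_f51s6_rel : FarKron.f51s6_rel.toFinset = (Finset.univ : Finset (Fin 6)).erase 0 := by decide

/-- **FAR `|A| = 5`, `j = 1`, `o ∉ A` on `Fin 6`** (`A = univ ∖ {o}`), every weight vector. [this work] -/
theorem farp_five_one_fin6 (w : Sym2 (Fin 6) → unitInterval) (A : Finset (Fin 6)) (o : Fin 6) (hoA : o ∉ A)
    (hA : A.card = 5) : FARp w A o 1 := by
  have hAo : A = Finset.univ.erase o := by
    apply Finset.eq_of_subset_of_card_le
    · intro x hx
      exact Finset.mem_erase.2 ⟨fun h => hoA (h ▸ hx), Finset.mem_univ x⟩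
    · rw [Finset.card_erase_of_mem (Finset.mem_univ o), Finset.card_univ, Fintype.card_fin, hA]
  refine FARp.of_generic A o 1 (fun w' hg => ?_) w
  refine FARp.of_relabel (Equiv.swap o 0) w' A o 1 ?_
  have hRm : A.map (Equiv.swap o 0).toEmbedding = FarKron.f51s6_rel.toFinset := by
    rw [hAo, Finset.map_erase, Finset.map_univ_equiv, toFinset_f51s6_rel, Equiv.toEmbedding_apply, Equiv.swap_apply_left]
  rw [hRm, Equiv.swap_apply_left]
  intro hEN t hcut
  exact FarKron.f51s6_canon (relabelW _ w') (xOf_open_of_generic _ (generic_relabelW _ w' hg))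
    (by push_cast at hEN; linarith) t (fun v hv => hcut v (List.mem_toFinset.2 hv))

/-- **FAR `|A| = 5`, `j = 1` on at most six vertices.** `o ∈ A`: elementary; `o ∉ A`: `n = 6` (`farp_five_one_fin6`). [this work] -/
theorem farp_five_one_of_card_le_six (hn : n ≤ 6) (w : Sym2 (Fin n) → unitInterval) (A : Finset (Fin n)) (o : Fin n)
    (hA : A.card = 5) : FARp w A o 1 := by
  by_cases hoA : o ∈ A
  · exact FARp.one_of_mem w A o hoA (by omega)
  have hAo : A.card + 1 ≤ n := by
    have h := Finset.card_le_univ (insert o A)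
    rw [Finset.card_insert_of_notMem hoA, Fintype.card_fin] at h
    exact h
  have h6 : n = 6 := by omega
  subst h6
  exact farp_five_one_fin6 w A o hoA hA

/-- `Quant.FarRelayRow`'s instance `|A| = 5`, `j = 1` for `n ≤ 6`, exact shape. [this work] -/
theorem farRelayRow_five_one_of_card_le_six (hn : n ≤ 6) (w : Sym2 (Fin n) → unitInterval) (A : Finset (Fin n)) (o : Fin n)
    (t : ℝ) (hA : A.card = 5) (hEN : (2 * 1 : ℝ) < ∑ a ∈ A, (prodBernoulli w).real (openConn o a))
    (hcut : ∀ a ∈ A, (prodBernoulli w).real (openConn o a)ᶜ ≤ t) :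
    (prodBernoulli w).real {ω : BondConfig (Fin n) | (A.filter fun a => ω ∈ openConn o a).card ≤ 1} ≤ t :=
  farp_five_one_of_card_le_six hn w A o hA (by push_cast; linarith) t hcut


/-! ## Layer 2 by the observer shift -/

/-- **Observer shift**: for `o ∈ A`, the FAR instance `(A, j+1)` follows from the instance `(A ∖ o, j)` (`N_A = N_{A∖o} + 1` surely,
`Σ_A = 1 + Σ_{A∖o}`; census-1's `QuantCensus.card_filter_conn_eq_erase_add_one` / `sum_conn_eq_one_add_erase`). [this work] -/
theorem FARp.succ_of_erase (w : Sym2 (Fin n) → unitInterval) (A : Finset (Fin n)) (o : Fin n) (hoA : o ∈ A) (j : ℕ)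
    (h : FARp w (A.erase o) o j) : FARp w A o (j + 1) := by
  intro hEN t hcut
  have hS := QuantCensus.sum_conn_eq_one_add_erase w A o hoA
  have hEN' : (2 * j : ℝ) < ∑ v ∈ A.erase o, (prodBernoulli w).real (openConn o v) := by
    rw [hS] at hEN; push_cast at hEN; linarith
  have key := h hEN' t (fun v hv => hcut v (Finset.mem_of_mem_erase hv))
  have hev : {ω : BondConfig (Fin n) | (A.filter fun v => ω ∈ openConn o v).card ≤ j + 1} =
      {ω : BondConfig (Fin n) | ((A.erase o).filter fun v => ω ∈ openConn o v).card ≤ j} := by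
    ext ω
    simp only [Set.mem_setOf_eq, QuantCensus.card_filter_conn_eq_erase_add_one A o hoA ω]
    omega
  rw [hev]
  exact key

/-- **FAR `|A| = 5`, `j = 2`, `o ∈ A` on at most six vertices** (shift to `|A∖o| = 4`, `j = 1`: `farp_four_one_of_card_le_six`). [this work] -/
theorem farp_five_two_of_mem_of_card_le_six (hn : n ≤ 6) (w : Sym2 (Fin n) → unitInterval) (A : Finset (Fin n)) (o : Fin n)
    (hoA : o ∈ A) (hA : A.card = 5) : FARp w A o 2 :=
  FARp.succ_of_erase w A o hoA 1 (farp_four_one_of_card_le_six hn w (A.erase o) o (by rw [Finset.card_erase_of_mem hoA, hA]))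

/-- **FAR `|A| = 6`, `j = 2` on at most six vertices** (`A = univ ∋ o`; shift to `|A∖o| = 5`, `j = 1`: `farp_five_one_of_card_le_six`). [this work] -/
theorem farp_six_two_of_card_le_six (hn : n ≤ 6) (w : Sym2 (Fin n) → unitInterval) (A : Finset (Fin n)) (o : Fin n)
    (hA : A.card = 6) : FARp w A o 2 := by
  have hAn : A.card ≤ n := by simpa using Finset.card_le_univ A
  have hn6 : n = 6 := by omega
  subst hn6
  have hAu : A = Finset.univ := Finset.eq_univ_of_card A (by rw [hA, Fintype.card_fin])
  have hoA : o ∈ A := by rw [hAu]; exact Finset.mem_univ o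
  exact FARp.succ_of_erase w A o hoA 1 (farp_five_one_of_card_le_six le_rfl w (A.erase o) o (by rw [Finset.card_erase_of_mem hoA, hA]))

end Summit.CriticalPhenomena.PercolationContinuityZ3.Theorems.TwoCopy
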